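import Mathlib
import Summits.CriticalPhenomena.PercolationContinuityZ3.Theorems.PercNearOneGluingNoHeavyLowerTailInternalEdgeGluing
import HarnessLib

/-!
# `NoHeavyLowerTail` (stmt-CriticalPhenomena-4575) — BOUNDARY gluing: the relays' unreliability may be measured after
# deleting only the BOUNDARY of a possible relay-free cluster of the observer (worst case over the cluster value)

Support file (depth prover `nh-dp-blobmono`, respawn g5; `--supports stmt-CriticalPhenomena-4575`).  Sequel to
`…InternalEdgeGluing.lean` (there: all pairs inside the closed region `R` deleted).  No definitions, no sorries.

`μ = prodBernoulli w` on `Fin n`, relays `A ∋ b`, closed region `R ∋ o` disjoint from `A`.  For a candidate value `V₀`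
(`o ∈ V₀ ⊆ R`) of the vertex set of `o`'s open relay-free cluster write `G − ∂V₀` for the weights with the pairs
from `V₀` to NON-RELAY vertices outside `V₀` set to `0` (the cluster's closed boundary; pairs inside `V₀`, inside
`R ∖ V₀`, and all ports are KEPT).

* `boundaryGluing` — if for EVERY `V₀` with `o ∈ V₀ ⊆ R` every relay has `μ_{G−∂V₀}(a ↮ b) ≤ θ`, then
  **`μ(o ↔ A) − μ(o ↔ b) ≤ θ`**.  Since `G − E(R) ≤ G − ∂V₀` edgewise for every such `V₀`, this contains
  `internalEdgeGluing` (hence KN Thm 4 additive, `pocketDeletionGluing`, `nearOneGluing_of_relayCore`,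
  `nearOneGluing_of_inessential`); it is strictly stronger when relays hang INSIDE the region (e.g. an observer at
  the end of a Steiner path with relay hairs: only ONE path edge is deleted at a time).  It is the sharpest
  DETERMINISTIC (cluster-value-independent) form of the blob decomposition: conditionally on the relay-free cluster
  being `V₀` the world is exactly `G − ∂V₀` with `V₀` glued, and what remains beyond it is the cluster-dependent
  selection term `Σ_{V₀} μ(Blob V₀) · max_a μ(a ↮ b | Blob V₀)` (lead (SEL), lf-6 `noHeavyLowerTail_of_portSelection`).
* Tools: `InternalEdge.reachable_contract_of_reachable_offBoundary` (an open `a–b` path avoiding the boundary pairs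
  of `V₀` survives the contraction, with stutter steps inside `V₀`), `InternalEdge.blobWeight_compl_le_killBoundary`.
-/

namespace Summit.CriticalPhenomena.PercolationContinuityZ3.Theorems

open MeasureTheory Set
open Literature.Probability.LatticeModels (prodBernoulli prodBernoulli_real_mono_of_isUpperSet)
open Literature.Probability.Percolation (BondConfig openConn openConnIn openGraph openGraph_adj
  isUpperSet_openConn)

noncomputable section
open Classical

variable {n : ℕ}

namespace InternalEdge

/-- **Path survival off the boundary.**  `o ∈ V₀`: if `x ↔ y` in `ω ∩ D`, `D` = all pairs
except those joining `V₀` to a non-relay outside `V₀`, then `φ x ↔ φ y` in the contraction `Ψ(ω)` (`φ` sends `V₀` to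
`o`); pairs inside `V₀` become stutter steps. [this work] -/
theorem reachable_contract_of_reachable_offBoundary {o : Fin n} {A V₀ : Finset (Fin n)} (ho : o ∈ V₀)
    (ω : BondConfig (Fin n)) {x y : Fin n}
    (hxy : (openGraph (ω ∩ {e : Sym2 (Fin n) |
      ¬ ((∃ u ∈ e, u ∈ V₀) ∧ ∃ v ∈ e, v ∉ V₀ ∧ v ∉ A)})).Reachable x y) :
    (openGraph ({e : Sym2 (Fin n) | (e ∈ ω ∧ ∀ v ∈ e, v ∉ V₀) ∨
        ∃ a ∈ A, e = s(o, a) ∧ ∃ u ∈ V₀, s(u, a) ∈ ω} : Set (Sym2 (Fin n)))).Reachable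
      (if x ∈ V₀ then o else x) (if y ∈ V₀ then o else y) := by
  set D : Set (Sym2 (Fin n)) := {e | ¬ ((∃ u ∈ e, u ∈ V₀) ∧ ∃ v ∈ e, v ∉ V₀ ∧ v ∉ A)} with hD
  set η : BondConfig (Fin n) := {e : Sym2 (Fin n) | (e ∈ ω ∧ ∀ v ∈ e, v ∉ V₀) ∨
        ∃ a ∈ A, e = s(o, a) ∧ ∃ u ∈ V₀, s(u, a) ∈ ω} with hη
  let φ : Fin n → Fin n := fun v => if v ∈ V₀ then o else v
  -- one step
  have hstep : ∀ u v : Fin n, (openGraph (ω ∩ D)).Adj u v → (openGraph η).Reachable (φ u) (φ v) := by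
    intro u v huv
    rw [openGraph_adj] at huv
    obtain ⟨⟨huvω, huvD⟩, hne⟩ := huv
    by_cases huV : u ∈ V₀
    · by_cases hvV : v ∈ V₀
      · simp only [φ, if_pos huV, if_pos hvV]  -- stutter
        exact SimpleGraph.Reachable.refl _
      · -- `v ∉ V₀`: since the pair is in `D`, `v ∈ A`: merged port
        have hvA : v ∈ A := by
          by_contra hvA
          exact huvD ⟨⟨u, Sym2.mem_mk_left u v, huV⟩, v, Sym2.mem_mk_right u v, hvV, hvA⟩
        have hvo : v ≠ o := fun h => hvV (h ▸ ho)
        simp only [φ, if_pos huV, if_neg hvV]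
        refine SimpleGraph.Adj.reachable ?_
        rw [openGraph_adj]
        exact ⟨Or.inr ⟨v, hvA, rfl, u, huV, huvω⟩, hvo.symm⟩
    · by_cases hvV : v ∈ V₀
      · have huA : u ∈ A := by
          by_contra huA
          exact huvD ⟨⟨v, Sym2.mem_mk_right u v, hvV⟩, u, Sym2.mem_mk_left u v, huV, huA⟩
        have huo : u ≠ o := fun h => huV (h ▸ ho)
        simp only [φ, if_neg huV, if_pos hvV]
        refine SimpleGraph.Adj.reachable ?_
        rw [openGraph_adj]
        refine ⟨Or.inr ⟨u, huA, Sym2.eq_swap, v, hvV, ?_⟩, huo⟩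
        rw [Sym2.eq_swap]; exact huvω
      · simp only [φ, if_neg huV, if_neg hvV]
        refine SimpleGraph.Adj.reachable ?_
        rw [openGraph_adj]
        refine ⟨Or.inl ⟨huvω, ?_⟩, hne⟩
        intro z hz
        rcases Sym2.mem_iff.1 hz with rfl | rfl
        · exact huV
        · exact hvV
  -- induction along the walk
  rw [SimpleGraph.reachable_iff_reflTransGen] at hxy
  induction hxy with
  | refl => exact SimpleGraph.Reachable.refl _
  | tail _ hadj ih => exact ih.trans (hstep _ _ hadj)

/-- **`μ_{w̃}(a ↮ b) ≤ μ_{G−∂V₀}(a ↮ b)`** for the blob weights `w̃` of `V₀ ∋ o` (disjoint from `A ∋ a, b`), where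
`G − ∂V₀` sets to `0` the pairs from `V₀` to non-relays outside `V₀`. [this work] -/
theorem blobWeight_compl_le_killBoundary (w : Sym2 (Fin n) → unitInterval) {o : Fin n} {A V₀ : Finset (Fin n)}
    (ho : o ∈ V₀) (hVA : Disjoint V₀ A) {a b : Fin n} (ha : a ∈ A) (hb : b ∈ A) :
    (prodBernoulli (fun e : Sym2 (Fin n) => (⟨(prodBernoulli w).real {ω : BondConfig (Fin n) |
        e ∈ ({e : Sym2 (Fin n) | (e ∈ ω ∧ ∀ v ∈ e, v ∉ V₀) ∨
          ∃ a ∈ A, e = s(o, a) ∧ ∃ u ∈ V₀, s(u, a) ∈ ω} : Set (Sym2 (Fin n)))},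
        ⟨measureReal_nonneg, measureReal_le_one⟩⟩ : unitInterval))).real (openConn a b)ᶜ ≤
      (prodBernoulli (fun e : Sym2 (Fin n) =>
        if ((∃ u ∈ e, u ∈ V₀) ∧ ∃ v ∈ e, v ∉ V₀ ∧ v ∉ A) then 0 else w e)).real (openConn a b)ᶜ := by
  set D : Set (Sym2 (Fin n)) := {e | ¬ ((∃ u ∈ e, u ∈ V₀) ∧ ∃ v ∈ e, v ∉ V₀ ∧ v ∉ A)} with hD
  set Ψ : BondConfig (Fin n) → BondConfig (Fin n) := fun ω =>
    ({e : Sym2 (Fin n) | (e ∈ ω ∧ ∀ v ∈ e, v ∉ V₀) ∨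
      ∃ a ∈ A, e = s(o, a) ∧ ∃ u ∈ V₀, s(u, a) ∈ ω} : BondConfig (Fin n)) with hΨ
  set kB : Sym2 (Fin n) → unitInterval :=
    fun e => if ((∃ u ∈ e, u ∈ V₀) ∧ ∃ v ∈ e, v ∉ V₀ ∧ v ∉ A) then 0 else w e with hkB
  set kD : Sym2 (Fin n) → unitInterval := fun e => if e ∈ D then w e else 0 with hkD
  have haV : a ∉ V₀ := fun h => Finset.disjoint_left.1 hVA h ha
  have hbV : b ∉ V₀ := fun h => Finset.disjoint_left.1 hVA h hb
  have hk : kD = kB := by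
    funext e
    simp only [hkD, hkB, hD, Set.mem_setOf_eq]
    by_cases h : (∃ u ∈ e, u ∈ V₀) ∧ ∃ v ∈ e, v ∉ V₀ ∧ v ∉ A
    · rw [if_neg (not_not.2 h), if_pos h]
    · rw [if_pos h, if_neg h]
  have hmap : (prodBernoulli w).map (fun ξ : BondConfig (Fin n) => ξ ∩ D) = prodBernoulli kD :=
    Literature.Probability.Percolation.prodBernoulli_map_inter w D
  have hmeasf : Measurable (fun ξ : BondConfig (Fin n) => ξ ∩ D) := Measurable.of_discrete
  have h1 : (prodBernoulli kB).real (openConn a b) =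
      (prodBernoulli w).real ((fun ξ : BondConfig (Fin n) => ξ ∩ D) ⁻¹' (openConn a b)) := by
    rw [← hk, ← hmap, measureReal_def, measureReal_def, Measure.map_apply hmeasf MeasurableSet.of_discrete]
  have h2 : (prodBernoulli w).real (Ψ ⁻¹' (openConn a b : Set (BondConfig (Fin n)))) =
      (prodBernoulli (fun e : Sym2 (Fin n) => (⟨(prodBernoulli w).real {ω : BondConfig (Fin n) | e ∈ Ψ ω},
        ⟨measureReal_nonneg, measureReal_le_one⟩⟩ : unitInterval))).real (openConn a b) :=
    SteinerBlob.measureReal_preimage_contract w hVA (openConn a b)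
  have hsub : ((fun ξ : BondConfig (Fin n) => ξ ∩ D) ⁻¹' (openConn a b : Set (BondConfig (Fin n)))) ⊆
      Ψ ⁻¹' (openConn a b : Set (BondConfig (Fin n))) := by
    intro ω hω
    have h := InternalEdge.reachable_contract_of_reachable_offBoundary (A := A) ho ω hω
    rw [if_neg haV, if_neg hbV] at h
    exact h
  have hmono := measureReal_mono hsub (measure_ne_top (prodBernoulli w) _)
  rw [probReal_compl_eq_one_sub (pocketGlue_measurableSet _),
    probReal_compl_eq_one_sub (pocketGlue_measurableSet _)]
  have : (prodBernoulli kB).real (openConn a b) ≤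
      (prodBernoulli (fun e : Sym2 (Fin n) => (⟨(prodBernoulli w).real {ω : BondConfig (Fin n) | e ∈ Ψ ω},
        ⟨measureReal_nonneg, measureReal_le_one⟩⟩ : unitInterval))).real (openConn a b) := by
    rw [h1, ← h2]; exact hmono
  linarith

end InternalEdge

/-- **Boundary gluing.**  Closed region `R ∋ o` disjoint from `A ∋ b`.  If for every `V₀` with `o ∈ V₀ ⊆ R` every
relay satisfies `μ_{G−∂V₀}(a ↮ b) ≤ θ` (pairs from `V₀` to non-relays outside `V₀` deleted, everything else kept),
then `μ(o ↔ A) − μ(o ↔ b) ≤ θ`. [this work; cite: KozmaNitzan2024, Thm. 4 (p. 12)] -/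
theorem boundaryGluing (w : Sym2 (Fin n) → unitInterval) (R A : Finset (Fin n)) (o b : Fin n) (θ : ℝ)
    (hbA : b ∈ A) (hoR : o ∈ R) (hRA : Disjoint R A)
    (hcl : ∀ x ∈ R, ∀ y : Fin n, y ∉ R → y ∉ A → w s(x, y) = 0)
    (hrel : ∀ V₀ : Finset (Fin n), o ∈ V₀ → V₀ ⊆ R → ∀ a ∈ A, (prodBernoulli (fun e : Sym2 (Fin n) =>
      if ((∃ u ∈ e, u ∈ V₀) ∧ ∃ v ∈ e, v ∉ V₀ ∧ v ∉ A) then 0 else w e)).real (openConn a b)ᶜ ≤ θ) :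
    (prodBernoulli w).real (⋃ a ∈ A, (openConn o a : Set (BondConfig (Fin n)))) -
      (prodBernoulli w).real (openConn o b) ≤ θ := by
  set μ := prodBernoulli w with hμ
  have hoA : o ∉ A := fun h => Finset.disjoint_left.1 hRA hoR h
  have hθ0 : 0 ≤ θ := by
    have h := hrel {o} (Finset.mem_singleton_self o) (Finset.singleton_subset_iff.2 hoR) b hbA
    have huniv : (openConn b b : Set (BondConfig (Fin n))) = Set.univ :=
      Set.eq_univ_of_forall fun _ => SimpleGraph.Reachable.refl _
    rw [huniv, Set.compl_univ, measureReal_empty] at h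
    exact h
  set EA : Set (BondConfig (Fin n)) := ⋃ a ∈ A, (openConn o a : Set (BondConfig (Fin n))) with hEA
  set Eb : Set (BondConfig (Fin n)) := openConn o b with hEb
  set 𝒱 : Finset (Finset (Fin n)) :=
    (Finset.univ : Finset (Finset (Fin n))).filter (fun V₀ => o ∈ V₀ ∧ Disjoint V₀ A) with h𝒱
  set Bl : Finset (Fin n) → Set (BondConfig (Fin n)) := fun V₀ =>
    {ω : BondConfig (Fin n) | (∀ u ∈ V₀, ω ∈ openConnIn (↑V₀ : Set (Fin n)) o u) ∧
      ∀ u ∈ V₀, ∀ x, x ∉ V₀ → x ∉ A → s(u, x) ∉ ω} with hBl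
  have hsumA : ∑ V₀ ∈ 𝒱, μ.real (EA ∩ Bl V₀) = μ.real EA := SteinerBlob.sum_measureReal_inter_blob w A o hoA EA
  have hsumb : ∑ V₀ ∈ 𝒱, μ.real (Eb ∩ Bl V₀) = μ.real Eb := SteinerBlob.sum_measureReal_inter_blob w A o hoA Eb
  have hsum1 : ∑ V₀ ∈ 𝒱, μ.real (Set.univ ∩ Bl V₀) = 1 := by
    rw [SteinerBlob.sum_measureReal_inter_blob w A o hoA Set.univ]; exact probReal_univ
  have hterm : ∀ V₀ ∈ 𝒱, μ.real (EA ∩ Bl V₀) - μ.real (Eb ∩ Bl V₀) ≤ θ * μ.real (Set.univ ∩ Bl V₀) := by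
    intro V₀ hV₀
    obtain ⟨ho, hVA⟩ := (Finset.mem_filter.1 hV₀).2
    rw [Set.univ_inter]
    by_cases hVR : V₀ ⊆ R
    · set Ψ : BondConfig (Fin n) → BondConfig (Fin n) := fun ω =>
        ({e : Sym2 (Fin n) | (e ∈ ω ∧ ∀ v ∈ e, v ∉ V₀) ∨
          ∃ a ∈ A, e = s(o, a) ∧ ∃ u ∈ V₀, s(u, a) ∈ ω} : BondConfig (Fin n)) with hΨ
      set wt : Sym2 (Fin n) → unitInterval := fun e => (⟨μ.real {ω : BondConfig (Fin n) | e ∈ Ψ ω},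
        ⟨measureReal_nonneg, measureReal_le_one⟩⟩ : unitInterval) with hwt
      have hreach : ∀ ω ∈ Bl V₀, ∀ a ∈ A, ((openGraph ω).Reachable o a ↔ (openGraph (Ψ ω)).Reachable o a) := by
        intro ω hω a ha
        have haV : a ∉ V₀ := fun h => Finset.disjoint_left.1 hVA h ha
        exact SteinerBlob.reachable_contract_iff ho hVA hω (Or.inl rfl) (Or.inr haV)
      have hEA' : EA ∩ Bl V₀ = Bl V₀ ∩ Ψ ⁻¹' EA := by
        ext ω
        simp only [hEA, Set.mem_inter_iff, Set.mem_preimage, Set.mem_iUnion, exists_prop]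
        constructor
        · rintro ⟨⟨a, ha, h⟩, hω⟩
          exact ⟨hω, a, ha, (hreach ω hω a ha).1 h⟩
        · rintro ⟨hω, a, ha, h⟩
          exact ⟨⟨a, ha, (hreach ω hω a ha).2 h⟩, hω⟩
      have hEb' : Eb ∩ Bl V₀ = Bl V₀ ∩ Ψ ⁻¹' Eb := by
        ext ω
        simp only [hEb, Set.mem_inter_iff, Set.mem_preimage]
        constructor
        · rintro ⟨h, hω⟩
          exact ⟨hω, (hreach ω hω b hbA).1 h⟩
        · rintro ⟨hω, h⟩
          exact ⟨(hreach ω hω b hbA).2 h, hω⟩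
      have hfacA : μ.real (EA ∩ Bl V₀) = μ.real (Bl V₀) * (prodBernoulli wt).real EA := by
        rw [hEA', SteinerBlob.measureReal_blob_inter_preimage_contract w hVA EA,
          SteinerBlob.measureReal_preimage_contract w hVA EA]
      have hfacb : μ.real (Eb ∩ Bl V₀) = μ.real (Bl V₀) * (prodBernoulli wt).real Eb := by
        rw [hEb', SteinerBlob.measureReal_blob_inter_preimage_contract w hVA Eb,
          SteinerBlob.measureReal_preimage_contract w hVA Eb]
      have hOA : Disjoint ({o} : Finset (Fin n)) A := Finset.disjoint_singleton_left.2 hoA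
      have hiso : ∀ x ∈ ({o} : Finset (Fin n)), ∀ y : Fin n, y ∉ ({o} : Finset (Fin n)) → y ∉ A →
          wt s(x, y) = 0 := by
        intro x hx y hyo hyA
        rw [Finset.mem_singleton] at hx hyo
        subst hx
        exact SteinerBlob.blobWeight_eq_zero w ho hyo hyA
      have hrel' : ∀ a ∈ A, (prodBernoulli (fun e : Sym2 (Fin n) =>
          if (∀ x ∈ e, x ∈ ({o} : Finset (Fin n))) ∧ ¬ e.IsDiag then 1 else wt e)).real (openConn a b)ᶜ ≤ θ := by
        intro a ha
        rw [agPartial_glue_singleton]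
        exact le_trans (InternalEdge.blobWeight_compl_le_killBoundary w ho hVA ha hbA) (hrel V₀ ho hVR a ha)
      have hbase := pocketGlue_base wt {o} A b θ hbA hOA hiso hrel'
      rw [agPartial_glue_singleton, Finset.set_biUnion_singleton, Finset.set_biUnion_singleton] at hbase
      rw [hfacA, hfacb]
      have hBl0 : 0 ≤ μ.real (Bl V₀) := measureReal_nonneg
      nlinarith [hbase, hBl0]
    · have h0 : μ.real (Bl V₀) = 0 := InternalEdge.blob_null w hoR hVA hcl hVR
      have h1 : μ.real (EA ∩ Bl V₀) ≤ μ.real (Bl V₀) :=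
        measureReal_mono Set.inter_subset_right (measure_ne_top μ _)
      have h2 : 0 ≤ μ.real (Eb ∩ Bl V₀) := measureReal_nonneg
      rw [h0] at h1 ⊢
      linarith
  rw [← hsumA, ← hsumb, ← Finset.sum_sub_distrib]
  calc ∑ V₀ ∈ 𝒱, (μ.real (EA ∩ Bl V₀) - μ.real (Eb ∩ Bl V₀))
      ≤ ∑ V₀ ∈ 𝒱, θ * μ.real (Set.univ ∩ Bl V₀) := Finset.sum_le_sum hterm
    _ = θ * ∑ V₀ ∈ 𝒱, μ.real (Set.univ ∩ Bl V₀) := by rw [Finset.mul_sum]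
    _ = θ := by rw [hsum1, mul_one]

end

end Summit.CriticalPhenomena.PercolationContinuityZ3.Theorems
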